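import Summits.HodgeConjecture.HodgeConjecture.Theorems.F0P3XiArchPacketOfRecord   -- ★ K6: `archPacketOfRecord : … → LocalAPacket (GKIrrClass (uFormGroup (Fin 2) (Fin 1)))` (+ ★ `LocalAPacket`, `GKIrrClass`, `uFormGroup`)
import HarnessLib

/-!
# (N) DEFS, FILE 1b — THE ARCHIMEDEAN PACKET KIT `ArchPacketKit` (POSITED packet data at the real place; Rogawski §12.3) and its trace functional

Cell `hodgecm-mathlib`, F0∕P3 «U3-mult», crux H413 (`stmt-HodgeConjecture-24833`); FILE 3 census `CENSUS-N-FILE3-SpectralTuple…md` c70774ab §T5 (n3-6)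
(F0P3a-p01 (g11), 2026-09-01): ★ FILE 2 `GlobalPacket 𝔩` is FINITE-PLACE ONLY, but the spectral letter's (T) and `trGS` read `Tr Π_∞(f_∞)` for EVERY packet `Π`,
not only for `Π(ξ)` — so the global tuple pairs a `GlobalPacket` with an ARCHIMEDEAN packet datum.  DEF LANE: ONE `structure` + two definitions + `rfl` read-backs;
no law, no instance, no notation, no named fact, no `sorry`.  ASSERTS NOTHING (posited data; the letters STF-T∕PK-F at `∞` are typed against `trPktInf`).

PRINT [Rogawski1990 §12.3 pp. 176–179 (the real packets `Π(φ)`, Prop. 12.3.3: `Π(ξ_∞) = {πⁿ(ξ_∞), πˢ(ξ_∞)}` = `{J_φ^±, D_φ}` in the cohomological window);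
§13.3 p. 203 «`Tr Π(f) = ∏_v Tr Π_v(f_v)`» — the archimedean factor].  CURRENCY: classes at `∞` are the V6 kit's tokens `Cinf = GKIrrClass (uFormGroup (Fin 2) (Fin 1))`
(★ `archPacketOfRecord … ξ : LocalAPacket Cinf`); the archimedean distribution character is a PARAMETER `archTr : Cinf → (X → ℂ) → ℂ` (the closer passes
★ `archTr₀ L ι H T hT νGi`), so this file is independent of the frame.

CONTENTS.  §1 `structure ArchPacketKit` (`PktInf`, `memInf`, `oneInf`).  §2 `trPktInf archTr P f := Σ_{c ∈ memInf P} oneInf P c · archTr c f`; `ContainsAPacketInf 𝔞 Pk`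
(the kit contains a packet with members `{Pk.πn} ∪ Pk.πs` and `⟨1, πⁿ⟩ = 1` — consumers instantiate `Pk := archPacketOfRecord ι μω jInf dsInf ξ`).  §3 `rfl`∕`Iff.rfl`.
HC_CM is proved only modulo the printed citations until rung 0 closes.
-/

set_option autoImplicit false
set_option linter.dupNamespace false

noncomputable section

open NumberField

namespace Summit.HodgeConjecture.HodgeConjecture.Cruxes.H413.F0P3ArchPacketKit

open Literature.NumberTheory.Rogawski1990 Literature.NumberTheory.Automorphic Literature.NumberTheory.GaloisRepresentations Literature.NumberTheory
open Literature.RepresentationTheory.BorelWallach2000 Literature.RepresentationTheory.KonnoKonno2007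

/-! ## §1 The posited packet data at the real place [§12.3] -/

/-- **`ArchPacketKit` — POSITED PACKET DATA OF `G′_∞` AT THE REAL PLACE** in the token currency `Cinf = GKIrrClass (uFormGroup (Fin 2) (Fin 1))` of the V6 kit:
a type `PktInf` of archimedean packets, their finite member sets `memInf`, and `oneInf P = ⟨1, ·⟩` (junk `0` off `memInf P`).  DATA ONLY; no law is asserted here.
[cite: Rogawski1990, §12.3 pp. 176–179, Prop. 12.3.3; §13.3 p. 203] -/
structure ArchPacketKit : Type 1 where
  /-- the archimedean packets (index type). -/
  PktInf : Type
  /-- the members of a packet (a finite set of `(𝔤, K)`-classes). -/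
  memInf : PktInf → Finset (GKIrrClass (uFormGroup (Fin 2) (Fin 1)))
  /-- `⟨1, c⟩` for `c ∈ memInf P` (junk `0` elsewhere). -/
  oneInf : PktInf → GKIrrClass (uFormGroup (Fin 2) (Fin 1)) → ℤ

namespace ArchPacketKit

/-! ## §2 The archimedean packet trace and the A-packet relation [p. 203; Prop. 12.3.3] -/

/-- **`Tr Π_∞(f_∞) := Σ_{c ∈ Π_∞} ⟨1, c⟩ · Θ_c(f_∞)`** for a given archimedean distribution character `archTr` (the closer's ★ `archTr₀ …`).
[cite: Rogawski1990, §13.3 p. 203; §14.5 p. 237] -/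
def trPktInf (𝔞 : ArchPacketKit) {X : Type} (archTr : GKIrrClass (uFormGroup (Fin 2) (Fin 1)) → (X → ℂ) → ℂ) (P : 𝔞.PktInf) (f : X → ℂ) : ℂ :=
  ∑ c ∈ 𝔞.memInf P, (𝔞.oneInf P c : ℂ) * archTr c f

/-- **«THE ARCHIMEDEAN A-PACKET `Pk` IS A PACKET OF THE KIT»**: some packet has members exactly `{Pk.πn} ∪ Pk.πs` and `⟨1, πⁿ⟩ = 1`; consumers take
`Pk := archPacketOfRecord ι μω jInf dsInf ξ` (★ K6; `πⁿ(ξ_∞) = J^±_φ`, `πˢ(ξ_∞) = D_φ`, Prop. 12.3.3); `⟨1, πˢ⟩` is not fixed here (PK-A's `ε`-datum).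
[cite: Rogawski1990, §12.3 Prop. 12.3.3 p. 178; §13.3 p. 203] -/
def ContainsAPacketInf (𝔞 : ArchPacketKit) (Pk : LocalAPacket (GKIrrClass (uFormGroup (Fin 2) (Fin 1)))) : Prop :=
  ∃ P : 𝔞.PktInf, (∀ c : GKIrrClass (uFormGroup (Fin 2) (Fin 1)), c ∈ 𝔞.memInf P ↔ (c = Pk.πn ∨ Pk.πs = some c)) ∧ 𝔞.oneInf P Pk.πn = 1

/-! ## §3 Unfoldings -/

/-- `trPktInf` unfolds to the signed member sum. [cite: Rogawski1990, §13.3 p. 203] -/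
theorem trPktInf_eq (𝔞 : ArchPacketKit) {X : Type} (archTr : GKIrrClass (uFormGroup (Fin 2) (Fin 1)) → (X → ℂ) → ℂ) (P : 𝔞.PktInf) (f : X → ℂ) :
    𝔞.trPktInf archTr P f = ∑ c ∈ 𝔞.memInf P, (𝔞.oneInf P c : ℂ) * archTr c f :=
  rfl

/-- Unfolding of `ContainsAPacketInf`. [cite: Rogawski1990, §12.3 Prop. 12.3.3 p. 178] -/
theorem containsAPacketInf_iff (𝔞 : ArchPacketKit) (Pk : LocalAPacket (GKIrrClass (uFormGroup (Fin 2) (Fin 1)))) :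
    𝔞.ContainsAPacketInf Pk ↔
      ∃ P : 𝔞.PktInf, (∀ c : GKIrrClass (uFormGroup (Fin 2) (Fin 1)), c ∈ 𝔞.memInf P ↔ (c = Pk.πn ∨ Pk.πs = some c)) ∧ 𝔞.oneInf P Pk.πn = 1 :=
  Iff.rfl

/-- **The ξ-instance**: the relation at the archimedean packet of record of `ξ` (★ K6 `archPacketOfRecord`), by name. [cite: Rogawski1990, §12.3 Prop. 12.3.3 p. 178] -/
theorem containsAPacketInf_archPacketOfRecord_iff (𝔞 : ArchPacketKit) {L : Type} [Field L] [NumberField L] [IsCMField L]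
    (ι : L →+* ℂ) (μω : HeckeCharacter L) (jInf dsInf : ℤ → ℤ → ℤ → GKIrrClass (uFormGroup (Fin 2) (Fin 1))) (ξ : OneDimAutRepH L) :
    𝔞.ContainsAPacketInf (F0P3XiArchPacketOfRecord.archPacketOfRecord ι μω jInf dsInf ξ) ↔
      ∃ P : 𝔞.PktInf, (∀ c : GKIrrClass (uFormGroup (Fin 2) (Fin 1)),
          c ∈ 𝔞.memInf P ↔ (c = (F0P3XiArchPacketOfRecord.archPacketOfRecord ι μω jInf dsInf ξ).πn ∨
            (F0P3XiArchPacketOfRecord.archPacketOfRecord ι μω jInf dsInf ξ).πs = some c)) ∧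
        𝔞.oneInf P (F0P3XiArchPacketOfRecord.archPacketOfRecord ι μω jInf dsInf ξ).πn = 1 :=
  Iff.rfl

end ArchPacketKit

end Summit.HodgeConjecture.HodgeConjecture.Cruxes.H413.F0P3ArchPacketKit
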